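import Literature.Probability.Percolation.Percolation
import Literature.Probability.LatticeModels.LatticeGraph
import HarnessLib

/-!
# Invasion percolation (Wilkinson–Willemsen 1983; Chayes–Chayes–Newman 1985, §2)

Invasion bond percolation on a locally finite simple graph `G` with i.i.d. EDGE labels `U : Sym2 V → ℝ` (the tree's `labelMeasure V`, `Percolation.lean` §"monotone coupling"), started at a root `o`:
the invaded region grows one vertex at a time, always through the boundary edge of SMALLEST label
(Chayes–Chayes–Newman 1985, §2 "The model": "at each step the bond on the boundary of the invaded region with the
smallest value is absorbed"; Wilkinson–Willemsen 1983, §2).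

* `Invasion.boundaryDarts G I` — the boundary darts `(x, y)` of a finite vertex set `I`: `x ∈ I`, `y ∉ I`, `x ∼ y`.
* `Invasion.minDarts G U I` — the boundary darts of minimal label `U s(x, y)`.
* `Invasion.newDart G U I` — the dart absorbed from `I` (a choice among the minimisers; `none` iff `I` has no
  boundary dart). Ties have probability zero under `labelMeasure` and every statement proved about the process
  holds for EVERY tie-breaking rule, so the choice is immaterial.
* `Invasion.step G U I` — one step: add the outer endpoint of the absorbed dart.
* `Invasion.invasion G U o n` — the invaded region after `n` steps (`{o}` at `n = 0`), a `Finset V`.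
* `Invasion.invadedRegion G U o` — the union over all times.
* `Invasion.acceptedLabel G U o n` — the label of the bond absorbed at step `n` (`0` if none), CCN's `x_n`.
* `Invasion.badCount G U o y n` — CCN's `M_n(y)`, the number of labels `> y` accepted before time `n`.
* `Invasion.exitIndex G U o Λ`, `Invasion.exitVertex G U o Λ` — CCN's break-out time `n_Λ` of a finite set `Λ` (first time the
  region is not inside `Λ`) and the vertex absorbed at that step.

Only definitions and their unfolding lemmas live here; the theory (greedy invariants, Chayes–Chayes–Newman's
Theorem 3.2, the critical acceptance profile and the zero density of the invaded region of `ℤ^d`) is in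
`Summits/CriticalPhenomena/PercolationContinuityZ3/Theorems/PercNearOneGluingNoHeavyRsw3Invasion*.lean`.

## References
* D. Wilkinson, J. F. Willemsen, *Invasion percolation: a new form of percolation theory*, J. Phys. A 16 (1983)
  3365–3376 [WilkinsonWillemsen1983].
* J. T. Chayes, L. Chayes, C. M. Newman, *The stochastic geometry of invasion percolation*, Comm. Math. Phys. 101
  (1985) 383–407, §2 [ChayesChayesNewman1985].
-/

noncomputable section

namespace Literature.Probability.Percolation

namespace Invasion

open Finset

variable {V : Type*} [DecidableEq V] (G : SimpleGraph V) [G.LocallyFinite]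

/-- The boundary darts of a finite vertex set `I`: ordered pairs `(x, y)` with `x ∈ I`, `y ∉ I` and `x ∼ y` in `G`
(the "bonds on the boundary of the invaded region", CCN 1985 §2). [cite: ChayesChayesNewman1985, §2 (the model)] -/
def boundaryDarts (I : Finset V) : Finset (V × V) :=
  I.biUnion fun x => ((G.neighborFinset x).filter fun y => y ∉ I).image fun y => (x, y)

/-- Membership in `boundaryDarts`. [cite: ChayesChayesNewman1985, §2 (the model)] -/
@[simp] theorem mem_boundaryDarts {I : Finset V} {a : V × V} :
    a ∈ boundaryDarts G I ↔ a.1 ∈ I ∧ a.2 ∉ I ∧ G.Adj a.1 a.2 := by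
  constructor
  · intro h
    simp only [boundaryDarts, mem_biUnion, mem_image, mem_filter, SimpleGraph.mem_neighborFinset] at h
    obtain ⟨x, hx, y, ⟨hxy, hy⟩, rfl⟩ := h
    exact ⟨hx, hy, hxy⟩
  · rintro ⟨h1, h2, h3⟩
    simp only [boundaryDarts, mem_biUnion, mem_image, mem_filter, SimpleGraph.mem_neighborFinset]
    exact ⟨a.1, h1, a.2, ⟨h3, h2⟩, rfl⟩

/-- The boundary darts of minimal label (`U s(x, y)` minimal among all boundary darts of `I`).
[cite: ChayesChayesNewman1985, §2 (the model: the boundary bond with the smallest value)] -/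
def minDarts (U : Sym2 V → ℝ) (I : Finset V) : Finset (V × V) :=
  (boundaryDarts G I).filter fun a => ∀ b ∈ boundaryDarts G I, U s(a.1, a.2) ≤ U s(b.1, b.2)

/-- Membership in `minDarts`. [cite: ChayesChayesNewman1985, §2 (the model)] -/
theorem mem_minDarts {U : Sym2 V → ℝ} {I : Finset V} {a : V × V} :
    a ∈ minDarts G U I ↔ a ∈ boundaryDarts G I ∧ ∀ b ∈ boundaryDarts G I, U s(a.1, a.2) ≤ U s(b.1, b.2) := by
  simp only [minDarts, mem_filter]

/-- A finite non-empty set of boundary darts has a dart of minimal label. [cite: ChayesChayesNewman1985, §2 (the model)] -/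
theorem minDarts_nonempty_iff {U : Sym2 V → ℝ} {I : Finset V} :
    (minDarts G U I).Nonempty ↔ (boundaryDarts G I).Nonempty := by
  constructor
  · rintro ⟨a, ha⟩
    exact ⟨a, ((mem_minDarts G).1 ha).1⟩
  · intro h
    obtain ⟨a, ha, hmin⟩ := exists_min_image (boundaryDarts G I) (fun b : V × V => U s(b.1, b.2)) h
    exact ⟨a, (mem_minDarts G).2 ⟨ha, hmin⟩⟩

/-- The dart absorbed from the invaded region `I`: some boundary dart of minimal label (a fixed choice among the
minimisers), or `none` when `I` has no boundary dart. [cite: ChayesChayesNewman1985, §2 (the model)] -/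
def newDart (U : Sym2 V → ℝ) (I : Finset V) : Option (V × V) :=
  if h : (minDarts G U I).Nonempty then some h.choose else none

/-- The absorbed dart is a boundary dart of minimal label. [cite: ChayesChayesNewman1985, §2 (the model)] -/
theorem newDart_mem {U : Sym2 V → ℝ} {I : Finset V} {a : V × V} (h : newDart G U I = some a) :
    a ∈ minDarts G U I := by
  unfold newDart at h
  split_ifs at h with hne
  cases h
  exact hne.choose_spec

/-- No dart is absorbed exactly when there is no boundary dart. [cite: ChayesChayesNewman1985, §2 (the model)] -/
theorem newDart_eq_none_iff {U : Sym2 V → ℝ} {I : Finset V} :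
    newDart G U I = none ↔ ¬ (boundaryDarts G I).Nonempty := by
  unfold newDart
  split_ifs with hne
  · simp only [false_iff, not_not]
    exact (minDarts_nonempty_iff G).1 hne
  · simp only [true_iff]
    exact fun h => hne ((minDarts_nonempty_iff G).2 h)

/-- `newDart` depends on the labels only through the set of minimising darts. [cite: ChayesChayesNewman1985, §2 (the model)] -/
theorem newDart_congr {U U' : Sym2 V → ℝ} {I : Finset V} (h : minDarts G U I = minDarts G U' I) :
    newDart G U I = newDart G U' I := by
  unfold newDart
  rw [h]

/-- One step of the invasion: absorb the minimal boundary bond, i.e. add its outer endpoint.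
[cite: ChayesChayesNewman1985, §2 (the model)] -/
def step (U : Sym2 V → ℝ) (I : Finset V) : Finset V :=
  match newDart G U I with
  | some a => insert a.2 I
  | none => I

/-- The invaded region after `n` steps, started from the root `o`. [cite: ChayesChayesNewman1985, §2 (the model)] -/
def invasion (U : Sym2 V → ℝ) (o : V) : ℕ → Finset V
  | 0 => {o}
  | n + 1 => step G U (invasion U o n)

/-- The whole invaded region `⋃ₙ Iₙ`. [cite: ChayesChayesNewman1985, §2 (the model)] -/
def invadedRegion (U : Sym2 V → ℝ) (o : V) : Set V :=
  {x | ∃ n, x ∈ invasion G U o n}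

/-- The label `x_n` of the bond absorbed at step `n` (`0` if nothing is absorbed).
[cite: ChayesChayesNewman1985, §2 (the random variables x_n)] -/
def acceptedLabel (U : Sym2 V → ℝ) (o : V) (n : ℕ) : ℝ :=
  match newDart G U (invasion G U o n) with
  | some a => U s(a.1, a.2)
  | none => 0

/-- CCN's `M_n(y)`: the number of bonds of label `> y` ("unoccupied at density `y`") absorbed during the first `n` steps.
[cite: ChayesChayesNewman1985, §3 eq. (3.4) (M_n(y))] -/
def badCount (U : Sym2 V → ℝ) (o : V) (y : ℝ) (n : ℕ) : ℕ :=
  ((Finset.range n).filter fun j => y < acceptedLabel G U o j).card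

/-- CCN's break-out time `n_Λ` of a finite vertex set `Λ ∋ o`: the first time at which the invaded region is not contained in
`Λ` (and `0` if it never leaves `Λ`). [cite: ChayesChayesNewman1985, §3 proof of Thm 3.2 (the stopping time n_{Λ_m})] -/
def exitIndex (U : Sym2 V → ℝ) (o : V) (Λ : Finset V) : ℕ :=
  by classical exact if h : ∃ n, ¬ invasion G U o n ⊆ Λ then Nat.find h else 0

/-- The break-out vertex: the vertex absorbed at the break-out step, i.e. the outer endpoint of the dart absorbed at time
`n_Λ - 1` (the root if there is none). [cite: ChayesChayesNewman1985, §3 proof of Thm 3.2 (the break-out site s ∈ ∂Λ_m)] -/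
def exitVertex (U : Sym2 V → ℝ) (o : V) (Λ : Finset V) : V :=
  match newDart G U (invasion G U o (exitIndex G U o Λ - 1)) with
  | some a => a.2
  | none => o

/-- `I₀ = {o}`. [cite: ChayesChayesNewman1985, §2 (the model)] -/
@[simp] theorem invasion_zero (U : Sym2 V → ℝ) (o : V) : invasion G U o 0 = {o} := rfl

/-- `I_{n+1} = step I_n`. [cite: ChayesChayesNewman1985, §2 (the model)] -/
theorem invasion_succ (U : Sym2 V → ℝ) (o : V) (n : ℕ) :
    invasion G U o (n + 1) = step G U (invasion G U o n) := rfl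

/-- The step when a dart `a` is absorbed. [cite: ChayesChayesNewman1985, §2 (the model)] -/
theorem step_of_eq_some {U : Sym2 V → ℝ} {I : Finset V} {a : V × V} (h : newDart G U I = some a) :
    step G U I = insert a.2 I := by
  simp only [step, h]

/-- The step when nothing is absorbed. [cite: ChayesChayesNewman1985, §2 (the model)] -/
theorem step_of_eq_none {U : Sym2 V → ℝ} {I : Finset V} (h : newDart G U I = none) :
    step G U I = I := by
  simp only [step, h]

/-- The accepted label when a dart `a` is absorbed at step `n`. [cite: ChayesChayesNewman1985, §2 (x_n)] -/
theorem acceptedLabel_of_eq_some {U : Sym2 V → ℝ} {o : V} {n : ℕ} {a : V × V}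
    (h : newDart G U (invasion G U o n) = some a) : acceptedLabel G U o n = U s(a.1, a.2) := by
  simp only [acceptedLabel, h]

/-- `M_0(y) = 0`. [cite: ChayesChayesNewman1985, §3 eq. (3.4)] -/
@[simp] theorem badCount_zero (U : Sym2 V → ℝ) (o : V) (y : ℝ) : badCount G U o y 0 = 0 := by
  simp [badCount]

/-- `M_{n+1}(y) = M_n(y) + [y < x_n]`. [cite: ChayesChayesNewman1985, §3 eq. (3.4)] -/
theorem badCount_succ (U : Sym2 V → ℝ) (o : V) (y : ℝ) (n : ℕ) :
    badCount G U o y (n + 1) = badCount G U o y n + (if y < acceptedLabel G U o n then 1 else 0) := by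
  rw [badCount, badCount, Finset.range_add_one, Finset.filter_insert]
  split_ifs with h
  · rw [Finset.card_insert_of_notMem (by simp)]
  · simp

/-- `n ↦ M_n(y)` is monotone. [cite: ChayesChayesNewman1985, §3 eq. (3.4)] -/
theorem badCount_mono (U : Sym2 V → ℝ) (o : V) (y : ℝ) : Monotone (badCount G U o y) := by
  intro m n hmn
  exact Finset.card_le_card (Finset.filter_subset_filter _ (Finset.range_subset_range.2 hmn))

/-- If the invaded region leaves `Λ` at some time, `n_Λ` is the first such time. [cite: ChayesChayesNewman1985, §3 proof of Thm 3.2] -/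
theorem exitIndex_spec {U : Sym2 V → ℝ} {o : V} {Λ : Finset V} (h : ∃ n, ¬ invasion G U o n ⊆ Λ) :
    ¬ invasion G U o (exitIndex G U o Λ) ⊆ Λ ∧ ∀ n < exitIndex G U o Λ, invasion G U o n ⊆ Λ := by
  classical
  simp only [exitIndex, dif_pos h]
  exact ⟨Nat.find_spec h, fun n hn => not_not.1 (Nat.find_min h hn)⟩

/-- Characterisation of `n_Λ = N` by its defining properties. [cite: ChayesChayesNewman1985, §3 proof of Thm 3.2] -/
theorem exitIndex_eq_iff {U : Sym2 V → ℝ} {o : V} {Λ : Finset V} (h : ∃ n, ¬ invasion G U o n ⊆ Λ) (N : ℕ) :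
    exitIndex G U o Λ = N ↔ ¬ invasion G U o N ⊆ Λ ∧ ∀ n < N, invasion G U o n ⊆ Λ := by
  classical
  simp only [exitIndex, dif_pos h, Nat.find_eq_iff, not_not]

/-- The break-out vertex when the dart `a` is absorbed at time `n_Λ - 1`. [cite: ChayesChayesNewman1985, §3 proof of Thm 3.2] -/
theorem exitVertex_of_eq_some {U : Sym2 V → ℝ} {o : V} {Λ : Finset V} {a : V × V}
    (h : newDart G U (invasion G U o (exitIndex G U o Λ - 1)) = some a) : exitVertex G U o Λ = a.2 := by
  simp only [exitVertex, h]

/-- Membership in the invaded region. [cite: ChayesChayesNewman1985, §2 (the model)] -/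
theorem mem_invadedRegion {U : Sym2 V → ℝ} {o x : V} :
    x ∈ invadedRegion G U o ↔ ∃ n, x ∈ invasion G U o n := Iff.rfl

end Invasion

end Literature.Probability.Percolation
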